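import Summits.ResolutionOfSingularities.ResolutionOfSingularities.Theorems.CylinderCutClasses
import HarnessLib

/-!
# CylinderCutClasses2 — decomp-res node «CylinderCut» (lens-2 g18), file 2/2 of `CylinderCutClasses`

Content VERBATIM from the decomp-res lens-2 g18 node `HOME/decomp-res-lens-2/g18/CylinderCut.lean` (pin d60dded1, 2
862 l; HOME = run/shared/lean/pub/decomp-res);
CRITIC-LEDGER row 150 (+1); landing orders INBOX :446: land the NEW PART ONLY (§C l. 2356–2619 + §U l. 2621–2859) —
the SplitCut restatement §R17 (l. 124–2354, itself
carrying g14–g17 verbatim) is DELETED and the landed modules imported instead (namespaces `…Theorems.PinchCut`,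
`…Theorems.JetCut`, `…Theorems.PurityCut`, `…Theorems.SplitCut`
opened; same short names, byte-identical bodies — never two copies).  Namespace `…Theorems.CylinderCut` (the lens's
`Theses.CylinderCut` is gate-reserved), sub-namespace `Cyl`
as in the lens; file split only (tree files ≤ 400 lines): sections, variables, the mid-file `open MvPolynomial` and
every declaration exactly as in the lens; the node's
global dupNamespace-linter line dropped.  Node files, in import order: `CylinderCutClasses` (§C + the cone-free head
of §U; continued `…2` where the cap cuts) ·
`CylinderCutCells` (§U2–§U4 cone-free: the aside home) · the wiring `MaxContactCutCylinderCut` (§C bridge kernel +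
§U BY NAME on the host route, in the Theses cone; imports
`MaxContactCutSplitCut` and the tree's `MaxContactCutTauLadder` ⊃ `MaxContactCutExhaustion`).  All `--supports
stmt-ResolutionOfSingularities-29273` (`MaxContactCut.RungOne`);
nothing closes 29273 — decided halves carry their engines as hypotheses (`JetCylinderExit` is a PORT: paper proof in
the lens docstring §C.2 / NODE-g18 §2); exactly ONE
located-residual aside on the lens-2 column (`Cyl.CylSpecialRung`, home `CylinderCutCells`) SUPERSEDES g17's
`Split.SplitSpecialRung`, re-located EXACTLY modulo the
cylinder decided half.

§C (NEW, g18): LAW (Cyl) — CYLINDERS ALONG THE TOP CURVE (critic window g18 (ii′): pure-power cones `ℓ^{p^s}` along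
the curve): `IsCylinderAlong`, `IsUniformCylinderCurve`, the ENGINE `def CylinderExit : Prop`, `IsCylinderCurvePt`,
the jet versions `IsJetCylinderAlong`, `IsUniformJetCylinderCurve`, the PORT-ENGINE `def JetCylinderExit : Prop`
(paper proof = lens docstring §C.2 / NODE-g18 §2; a hypothesis here), `IsJetCylinderCurvePt`, the kernels
`isJetCylinderAlong_of_isCylinderAlong` / `cylinderExit_of_jetCylinderExit` /
`isCurveExitPt_of_is(Jet)CylinderCurvePt` (those through `MaxOrderAtomClasses.MaxOrderThreefoldResolutionEmptyAt`,
cone-free), §C.3 the inseparability kernel `InsepKernel`, and the cone-free head of §U (the leaf `cylLeaf =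
splitLeaf ∨ (Cyl) ∨ (JCyl)` + order lemmas, the located residual class `IsCylSpecialPt` + iffs).  The bridge kernel
`weakResolution_of_isResolutionOf` (tree kernels `MaxContactCutExhaustion` / `MaxContactCutTauLadder` BY NAME) and
`cylinderExit_of_ports` (tree aside 30081 BY NAME) are in the wiring file.

Part 2/2 carries: `cylLeaf_of_isCylinderCurvePt`, `cylLeaf_of_isJetCylinderCurvePt`, `IsCylSpecialPt`,
`isSpecPt_cylLeaf_iff`, `isSplitSpecialPt_of_isCylSpecialPt`, `isSplitSpecialPt_iff`.

(Sources: Hironaka1964 Ch. III; CossartJannsenSaito2020 Ch. 2, Ch. 8–9; CossartPiltant2008 Prop. 4.2;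
CossartPiltant2019 Rem. 3.2; BierstoneGrigorievMilmanWlodarczyk2011 §3.1; Moh1987; Hauser2010Kangaroo; Giraud1975;
Narasimhan1983.)
-/

open CategoryTheory AlgebraicGeometry TopologicalSpace IsLocalRing
open Literature.AlgebraicGeometry.Resolution
open Summit.ResolutionOfSingularities.ResolutionOfSingularities.Theorems
open Summit.ResolutionOfSingularities.ResolutionOfSingularities.Theorems.WeakOrderReduction
open Summit.ResolutionOfSingularities.ResolutionOfSingularities.Theorems.DeltaFaceCutClasses
open Summit.ResolutionOfSingularities.ResolutionOfSingularities.Theorems.RelativeDeltaCut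
open Summit.ResolutionOfSingularities.ResolutionOfSingularities.Theorems.CurveLeafExit
open Summit.ResolutionOfSingularities.ResolutionOfSingularities.Theorems.PinchCut
open Summit.ResolutionOfSingularities.ResolutionOfSingularities.Theorems.JetCut
open Summit.ResolutionOfSingularities.ResolutionOfSingularities.Theorems.PurityCut
open Summit.ResolutionOfSingularities.ResolutionOfSingularities.Theorems.SplitCut

namespace Summit.ResolutionOfSingularities.ResolutionOfSingularities.Theorems.CylinderCut

/-- `cylLeaf_of_isCylinderCurvePt`: Auxiliary step of this node's calculus, VERBATIM from the lens file (see the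
module docstring); the statement is its type. [folklore] -/
theorem cylLeaf_of_isCylinderCurvePt ⦃Y : Scheme.{0}⦄ {I : Y.IdealSheafData} {n : ℕ} {y : Y}
    (h : IsCylinderCurvePt I n y) : cylLeaf I n y :=
  Or.inr (Or.inl h)

/-- `cylLeaf_of_isJetCylinderCurvePt`: Auxiliary step of this node's calculus, VERBATIM from the lens file (see the
module docstring); the statement is its type. [folklore] -/
theorem cylLeaf_of_isJetCylinderCurvePt ⦃Y : Scheme.{0}⦄ {I : Y.IdealSheafData} {n : ℕ} {y : Y}
    (h : IsJetCylinderCurvePt I n y) : cylLeaf I n y :=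
  Or.inr (Or.inr h)

/-- **CYLINDER-SPECIAL point** [g18] — THE LOCATED RESIDUAL CLASS of this node: split-special (g17) and NEITHER a
cylinder-curve point NOR
a jet-cylinder-curve point — the GENUINELY `v`-DEPENDENT side of the structural dichotomy.  What is LEFT (booked,
module docstring /
NODE §7): pure-power cones whose tail varies with `v` below the jet modulus (`(z + vU)² + u₁⁵ + v·u₂⁵ + u₂⁷`: `h = v
u₂⁵ ∈ 𝒫⁵` only),
moving cylinders (the translation direction is a curve transversal to nothing: `(z + vU)² + (u₁ + v u₂)⁵ + u₂⁷` is
STILL a cylinder in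
the frame `u₁' = u₁ + v u₂` — the class is frame-free — but `(z + vU)² + u₁⁵ + u₂⁷ + v u₁³u₂³` is not), deep splits
`z(z + v²U)`,
split cones with `n ∣ k`, NON-PRINCIPAL `I_y` (iii), Tangle (`R1-notail`), Sing / Iso (iv).  DEFINITION (NEW class).
[folklore] -/
def IsCylSpecialPt {k : Type} [Field k] {Y : Scheme.{0}} (g : Y ⟶ Spec (.of k)) (hY : Scheme.IsRegular Y)
    (I : Y.IdealSheafData) (n : ℕ) (y : Y) : Prop :=
  IsSplitSpecialPt g hY I n y ∧ ¬ IsCylinderCurvePt I n y ∧ ¬ IsJetCylinderCurvePt I n y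

/-- Pointwise: the cylinder-special class IS the `cylLeaf`-special class of §G.  KERNEL (PROVED). [folklore] -/
theorem isSpecPt_cylLeaf_iff {k : Type} [Field k] {Y : Scheme.{0}} (g : Y ⟶ Spec (.of k)) (hY : Scheme.IsRegular Y)
    (I : Y.IdealSheafData) (n : ℕ) (y : Y) : Leaf.IsSpecPt cylLeaf g hY I n y ↔ IsCylSpecialPt g hY I n y := by
  constructor
  · rintro ⟨hL, hno⟩
    refine ⟨(isSpecPt_splitLeaf_iff g hY I n y).mp ⟨hL, fun h => hno (Or.inl h)⟩, fun h => hno (Or.inr (Or.inl h)),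
      fun h => hno (Or.inr (Or.inr h))⟩
  · rintro ⟨hS, hC, hJ⟩
    obtain ⟨hL, hno⟩ := (isSpecPt_splitLeaf_iff g hY I n y).mpr hS
    refine ⟨hL, ?_⟩
    rintro (h | h | h)
    · exact hno h
    · exact hC h
    · exact hJ h

/-- The cylinder-special class is contained in g17's split-special class (the residual SHRINKS by letter).  KERNEL
(PROVED). [folklore] -/
theorem isSplitSpecialPt_of_isCylSpecialPt {k : Type} [Field k] {Y : Scheme.{0}} {g : Y ⟶ Spec (.of k)}
    {hY : Scheme.IsRegular Y} {I : Y.IdealSheafData} {n : ℕ} {y : Y} (h : IsCylSpecialPt g hY I n y) :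
    IsSplitSpecialPt g hY I n y :=
  h.1

/-- **EXACT POINTWISE DICHOTOMY of g17's residual class** (the structural dichotomy at a point): split-special ⟺
(split-special and on
a cylinder or jet-cylinder curve) ∨ cylinder-special.  KERNEL (PROVED). [folklore] -/
theorem isSplitSpecialPt_iff {k : Type} [Field k] {Y : Scheme.{0}} (g : Y ⟶ Spec (.of k)) (hY : Scheme.IsRegular Y)
    (I : Y.IdealSheafData) (n : ℕ) (y : Y) :
    IsSplitSpecialPt g hY I n y ↔
      (IsSplitSpecialPt g hY I n y ∧ (IsCylinderCurvePt I n y ∨ IsJetCylinderCurvePt I n y)) ∨ IsCylSpecialPt g hY I n y := by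
  constructor
  · intro h
    by_cases hc : IsCylinderCurvePt I n y
    · exact Or.inl ⟨h, Or.inl hc⟩
    · by_cases hj : IsJetCylinderCurvePt I n y
      · exact Or.inl ⟨h, Or.inr hj⟩
      · exact Or.inr ⟨h, hc, hj⟩
  · rintro (⟨h, _⟩ | ⟨h, _⟩) <;> exact h

end Summit.ResolutionOfSingularities.ResolutionOfSingularities.Theorems.CylinderCut
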